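import Summits.QuantumAdvantage.QuantumAdvantage.Theses.HankelLift
import Literature.Computability.Cryptography.VanDamSeroussiOracleBQP
import Literature.Computability.Complexity.CodeFPArith

/-!
# `HankelLift.LiouvilleSumMemBQP` (stmt-QuantumAdvantage-18442): the lifted Liouville pair-language
# is in `BQP`

Route `route-QuantumAdvantage-HankelLift`, support item `LiouvilleSumMemBQP`: the language

  `L⁺ = {⟨bits_n x, bits_n y⟩ : n, x, y ∈ ℕ, x, y < 2^n, λ(x+y+2) = −1}`

(`⟨·,·⟩ = boolPair`, `bits_n x = List.ofFn (fun i : Fin n => Nat.testBit x i)`, LSB first) is in the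
tree's strict class `Literature.Computability.Cryptography.BQP`.

Proof (Shor 1997 §5 + one classical wrap, the pattern of
`Theorems/MobiusLadderLiouvilleMemBQP.lean`): run the tree's factoring family
(`factoring_mem_FBQP_holds`) on the PRE-processed input `w ↦ bin(val(fst w) + val(snd w) + 2)` (an `FP`
map assembled in the typed `CodeFP` algebra: `strVal`, `natAdd`, `strOfNat`), wrap it classically
(`isQSolvable_classicalWrap_holds`) with the `FP` POST-processor
`⟨w, y⟩ ↦ [w is a well-formed pair ∧ |fst w| = |snd w| ∧ |parseF y| is odd]`, and read wire `0`
(`mem_BQP_of_isQSolvable_bit`): the bit is `true` iff `w ∈ L⁺`, because a well-formed pair of two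
length-`n` bit blocks is exactly `⟨bits_n x, bits_n y⟩` for `x = val(fst w)`, `y = val(snd w) < 2^n`, and
`λ(N) = −1` iff `|primeFactorsList N|` is odd (as in `MobiusLadder.liouville_eq_neg_one_iff`).
Everything used is proved in the tree; no definition, no named fact; no route-cone import (the two small
`MobiusLadder` lemmas are re-derived inline rather than imported through that route's theorem file).
-/

set_option linter.dupNamespace false -- D-0017: single-problem summit ⇒ `QuantumAdvantage.QuantumAdvantage` by design

namespace Summit.QuantumAdvantage.QuantumAdvantage.Theorems.HankelLift

open _root_.Computability
open Literature.Computability.Complexity Literature.Computability.Cryptography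
open Literature.Computability.Complexity.Brick Literature.Computability.Complexity.CodeFP

/-! ### Fixed-width LSB-first bit blocks -/

/-- Reading back a bit block: the width-`|u|` LSB-first bits of `val(u)` are `u`. [folklore] -/
theorem ofFn_testBit_bitsToNat : ∀ (u : List Bool),
    (List.ofFn fun i : Fin u.length => Nat.testBit (bitsToNat u) i) = u
  | [] => by simp
  | b :: u => by
    show List.ofFn (fun i : Fin (u.length + 1) => Nat.testBit (bitsToNat (b :: u)) i) = b :: u
    rw [List.ofFn_succ, bitsToNat_cons]
    congr 1
    · simp only [Fin.val_zero, Nat.testBit_zero]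
      cases b <;> simp
    · conv_rhs => rw [← ofFn_testBit_bitsToNat u]
      congr 1
      funext i
      rw [Fin.val_succ, Nat.testBit_add_one]
      congr 1
      have := Bool.toNat_le b
      omega

/-- The value of the width-`n` LSB-first bit block of `x < 2^n` is `x`. [folklore] -/
theorem bitsToNat_ofFn_testBit : ∀ {n x : ℕ}, x < 2 ^ n →
    bitsToNat (List.ofFn fun i : Fin n => Nat.testBit x i) = x
  | 0, x, hx => by simp at hx; simp [hx]
  | n + 1, x, hx => by
    rw [List.ofFn_succ, bitsToNat_cons]
    have h2 : x / 2 < 2 ^ n := by rw [pow_succ] at hx; omega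
    have ih := bitsToNat_ofFn_testBit h2
    simp only [Fin.val_succ, Nat.testBit_add_one, Fin.val_zero, Nat.testBit_zero] at ih ⊢
    rw [ih]
    rcases Nat.mod_two_eq_zero_or_one x with h | h <;> simp [h] <;> omega

/-! ### The pre- and post-processors, in the typed `CodeFP` algebra -/

/-- `fstF` on strings. [folklore] -/
private theorem codeFP_fstF : CodeFP strE strE fstF := ⟨fstF, fstF_mem_FP, fun _ => rfl⟩

/-- `sndF` on strings. [folklore] -/
private theorem codeFP_sndF : CodeFP strE strE sndF := ⟨sndF, sndF_mem_FP, fun _ => rfl⟩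

/-- **The pre-processor is polynomial time**: `w ↦ bin(val(fst w) + val(snd w) + 2)` (two numeral
reads, two additions, one re-encoding). [folklore] -/
theorem exists_pre : ∃ h ∈ FP, ∀ w : List Bool,
    h w = encodeNat (bitsToNat (fstF w) + bitsToNat (sndF w) + 2) := by
  have hc : CodeFP strE strE (fun w => natE (bitsToNat (fstF w) + bitsToNat (sndF w) + 2)) :=
    (strOfNat.comp ((natAdd.comp (((natAdd.comp ((strVal.comp codeFP_fstF).pair
      (strVal.comp codeFP_sndF)))).pair (CodeFP.const strE 2))))).congr fun _ => rfl
  obtain ⟨h, hh, hspec⟩ := hc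
  exact ⟨h, hh, fun w => hspec w⟩

/-- **The well-formed-pair test is polynomial time**: `w ↦ [⟨fst w, snd w⟩ = w]` (re-pair and
compare). [folklore] -/
theorem codeFP_wellFormedPair :
    CodeFP strE bitE (fun w => decide (boolPair (fstF w) (sndF w) = w)) := by
  have hre : CodeFP strE strE (fun w => boolPair (fstF w) (sndF w)) := by
    obtain ⟨f, hf, h⟩ := codeFP_fstF.pair codeFP_sndF
    exact ⟨f, hf, fun w => by rw [h]; rfl⟩
  exact ((CodeFP.eq (eα := strE) Function.injective_id).comp (hre.pair (CodeFP.id strE))).congr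
    fun _ => rfl

/-- **The equal-length test is polynomial time**: `w ↦ [|fst w| = |snd w|]` (unary lengths,
compared as strings). [folklore] -/
theorem codeFP_sameLength :
    CodeFP strE bitE (fun w => decide ((fstF w).length = (sndF w).length)) :=
  ((CodeFP.eq unE_injective).comp ((strLength.comp codeFP_fstF).pair
    (strLength.comp codeFP_sndF))).congr fun _ => rfl

/-- **The post-processor is polynomial time**: on `v = ⟨w, y⟩`,
`[⟨fst w, snd w⟩ = w ∧ |fst w| = |snd w| ∧ |parseF y| odd]`. [folklore] -/
theorem codeFP_post : CodeFP strE bitE (fun v =>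
    (decide (boolPair (fstF (fstF v)) (sndF (fstF v)) = fstF v) &&
      decide ((fstF (fstF v)).length = (sndF (fstF v)).length)) &&
      decide ((VDSOracle.parseF (sndF v)).length % 2 = 1)) := by
  have h1 := (codeFP_wellFormedPair.and codeFP_sameLength).comp codeFP_fstF
  -- parity of a numeral, `n ↦ [n % 2 = 1]` (as in `MobiusLadder.codeFP_natOdd`)
  have hodd : CodeFP natE bitE (fun n : ℕ => decide (n % 2 = 1)) :=
    (natEq.comp ((natMod.comp ((CodeFP.id natE).pair (const natE 2))).pair (const natE 1))).congr
      fun _ => rfl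
  have h2 := hodd.comp ((natLength natE).comp (VDSOracle.codeFP_parseF.comp codeFP_sndF))
  exact (h1.and h2).congr fun _ => rfl

/-- The post-processor as an `FP` string function with its value on pairs. [folklore] -/
theorem exists_post : ∃ g ∈ FP, ∀ w y : List Bool, g (boolPair w y) =
    [(decide (boolPair (fstF w) (sndF w) = w) && decide ((fstF w).length = (sndF w).length)) &&
      decide ((VDSOracle.parseF y).length % 2 = 1)] := by
  obtain ⟨g, hg, h⟩ := codeFP_post
  refine ⟨g, hg, fun w y => ?_⟩
  have := h (boolPair w y)
  simp only [fstF_boolPair, sndF_boolPair] at this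
  exact this

/-! ### The answer bit decides the lifted language -/

/-- **The answer bit of `L⁺`**: `[⟨fst w, snd w⟩ = w ∧ |fst w| = |snd w| ∧
|primeFactorsList (val(fst w) + val(snd w) + 2)| odd]` is `true` iff `w ∈ L⁺`. [folklore] -/
theorem sumBit_eq_true_iff (w : List Bool) :
    ((decide (boolPair (fstF w) (sndF w) = w) && decide ((fstF w).length = (sndF w).length)) &&
      decide ((bitsToNat (fstF w) + bitsToNat (sndF w) + 2).primeFactorsList.length % 2 = 1)) = true ↔
    w ∈ ({w | ∃ n x y : ℕ, x < 2 ^ n ∧ y < 2 ^ n ∧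
      w = boolPair (List.ofFn fun i : Fin n => Nat.testBit x i)
        (List.ofFn fun i : Fin n => Nat.testBit y i) ∧
      ArithmeticFunction.liouville (x + y + 2) = -1} : Set (List Bool)) := by
  -- `λ(N) = −1 ↔ |primeFactorsList N| odd` (as in `MobiusLadder.liouville_eq_neg_one_iff`)
  have hiff : ∀ N : ℕ, ArithmeticFunction.liouville N = -1 ↔ N.primeFactorsList.length % 2 = 1 := by
    intro N
    rcases Nat.eq_zero_or_pos N with rfl | hN
    · simp [Nat.primeFactorsList_zero]
    · rw [ArithmeticFunction.liouville_apply hN.ne', ArithmeticFunction.cardFactors_apply, ← Nat.odd_iff]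
      constructor
      · intro h
        rcases Nat.even_or_odd N.primeFactorsList.length with he | ho
        · rw [he.neg_one_pow] at h
          norm_num at h
        · exact ho
      · intro ho
        exact ho.neg_one_pow
  rw [Set.mem_setOf_eq, Bool.and_eq_true, Bool.and_eq_true, decide_eq_true_eq, decide_eq_true_eq,
    decide_eq_true_eq, ← hiff]
  constructor
  · rintro ⟨⟨hwf, hlen⟩, hlam⟩
    refine ⟨(fstF w).length, bitsToNat (fstF w), bitsToNat (sndF w), bitsToNat_lt _,
      hlen ▸ bitsToNat_lt _, ?_, hlam⟩
    conv_lhs => rw [← hwf]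
    congr 1
    · exact (ofFn_testBit_bitsToNat _).symm
    · rw [hlen]; exact (ofFn_testBit_bitsToNat _).symm
  · rintro ⟨n, x, y, hx, hy, rfl, hlam⟩
    simp only [fstF_boolPair, sndF_boolPair, List.length_ofFn, bitsToNat_ofFn_testBit hx,
      bitsToNat_ofFn_testBit hy]
    exact ⟨⟨trivial, trivial⟩, hlam⟩

/-! ### The language is in `BQP` -/

/-- **`L⁺ ∈ BQP` from Shor's theorem in `FBQP` form**: run the factoring family on the pre-processed
numeral `bin(x+y+2)` (`exists_pre`), wrap it classically with the post-processor of `exists_post`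
(`isQSolvable_classicalWrap_holds`), observe that the wrapped family writes the answer bit of
`sumBit_eq_true_iff` first (`VDSOracle.parseF_certCode_append`), and read wire `0`
(`mem_BQP_of_isQSolvable_bit`). [cite: Shor1997, §5] [cite: BernsteinVazirani1997, Def. 8 and §8] -/
theorem liouvilleSumMemBQP_of_factoring (hShor : factoring_mem_FBQP) :
    ({w | ∃ n x y : ℕ, x < 2 ^ n ∧ y < 2 ^ n ∧
      w = boolPair (List.ofFn fun i : Fin n => Nat.testBit x i)
        (List.ofFn fun i : Fin n => Nat.testBit y i) ∧
      ArithmeticFunction.liouville (x + y + 2) = -1} : Set (List Bool)) ∈ BQP := by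
  obtain ⟨h, hh, hpre⟩ := exists_pre
  obtain ⟨g, hg, hpost⟩ := exists_post
  have hF : IsQSolvable fun x =>
      {y : List Bool | encodingListNatBool.encode (decodeNat x).primeFactorsList <+: y} := hShor
  have hW := isQSolvable_classicalWrap_holds h g hh hg hF
  have hbit : IsQSolvable fun w => {z |
      [(decide (boolPair (fstF w) (sndF w) = w) && decide ((fstF w).length = (sndF w).length)) &&
        decide ((bitsToNat (fstF w) + bitsToNat (sndF w) + 2).primeFactorsList.length % 2 = 1)]
        <+: z} := by
    refine hW.mono fun w z hz => ?_
    obtain ⟨y, hy, hz⟩ := hz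
    simp only [Set.mem_setOf_eq] at hy
    rw [hpre, decode_encodeNat, VDSOracle.encode_primeFactorsList_eq] at hy
    obtain ⟨pad, rfl⟩ := hy
    rw [hpost, VDSOracle.parseF_certCode_append] at hz
    exact hz
  exact mem_BQP_of_isQSolvable_bit (fun _ _ => QCircuit.outputPMF_apply_holds) cliffordT_isUnitary_holds
    sumBit_eq_true_iff hbit

/-- Settles `stmt-QuantumAdvantage-18442` (route HankelLift, support `LiouvilleSumMemBQP`): **the lifted
Liouville pair-language `{⟨bits_n x, bits_n y⟩ : λ(x+y+2) = −1}` is in `BQP`** —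
`liouvilleSumMemBQP_of_factoring` applied to the tree's discharged Shor theorem
`factoring_mem_FBQP_holds`. [cite: Shor1997, §5] -/
theorem liouvilleSumMemBQP_proof :
    Summit.QuantumAdvantage.QuantumAdvantage.Theses.HankelLift.LiouvilleSumMemBQP := by
  unfold Summit.QuantumAdvantage.QuantumAdvantage.Theses.HankelLift.LiouvilleSumMemBQP
  exact liouvilleSumMemBQP_of_factoring factoring_mem_FBQP_holds

end Summit.QuantumAdvantage.QuantumAdvantage.Theorems.HankelLift
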